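import Mathlib
import Summits.KontsevichZagierPeriods.KontsevichZagierPeriods.Theorems.SoloInformedHoffmanB
import Summits.KontsevichZagierPeriods.KontsevichZagierPeriods.Theorems.SoloInformedSumPieces
import Summits.KontsevichZagierPeriods.KontsevichZagierPeriods.Theorems.SoloInformedWordEnds
import HarnessLib
import HarnessLib.Audit

/-!
# SoloInformed — Hoffman's relation: the garland chart of the integral side (file 3)

Solo programme `solo-KontsevichZagierPeriods-informed`, session s48 (PROGRAMME L). Dimension
`n = m + 2`; `u` admissible of weight `m + 1`, word `ε = ε(u)` on `Fin (m+1)` (`ε_m = 1`).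

The left side of the Hoffman scale step is `A = [(0,1)ⁿ ∩ {Y < x₀}, F_ε(x)/(1 − Y)]`
(`soloInformedHofDatum.repA`, `Y = x_{m+1}`).  The substitution
`λ(x) = (x₀, x₀x₁, …, x₀⋯x_m, Y)` carries it (rule (2)) onto the GARLAND representation

  `G = [(0,1)ⁿ ∩ P_E, g]`,  `g(t) = (∏_{k ≤ m} ω_{ε_k}(t_k)) · ω₁(t_{m+1})`,

`P_E` the order polytope of the garland poset `E` = the chain `t₀ > t₁ > ⋯ > t_m` plus the pendant
`t_{m+1} < t₀`.  This is Yamamoto's integral `I` of the 2-poset "`u` with one extra maximal-free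
vertex below the top", i.e. Kaneko–Yamamoto's integral side for `μ((1), u)`.  Contents (a port
of `SoloInformedSumChart` from the depth-2 word to a general word): poset, `λ`, its triangular
Jacobian `det J_λ = ∏_{j<m} λ_j`, injectivity and image.  (The pull-back identity, MOVE A and the
dissection follow in `SoloInformedHoffmanPieces`.)

References: S. Yamamoto, arXiv:1405.6499 Thm 1.2; M. Kaneko, S. Yamamoto, arXiv:1605.03117 §4;
Kontsevich–Zagier 2001 §1.2.
-/

noncomputable section

open MeasureTheory Set MvPolynomial
open Literature.ModelTheory.ExponentialFields Literature.NumberTheory.Transcendental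
open Literature.NumberTheory.Transcendental.KZ

namespace Summit.KontsevichZagierPeriods.KontsevichZagierPeriods.Theorems

variable {m : ℕ}

/-! ## 1. The garland poset -/

/-- The garland poset in dimension `m+2`: the chain `(j+1, j)` for `j < m` and the pendant
`(m+1, 0)` (pairs `(a, b)` mean `t_a < t_b`). -/
def soloInformedHofPoset (m : ℕ) : List (Fin (m + 2) × Fin (m + 2)) :=
  (List.finRange m).map (fun j => (Fin.castSucc j.succ, Fin.castSucc (Fin.castSucc j))) ++
    [(Fin.last (m + 1), 0)]

/-- Membership in the garland order polytope. -/
theorem soloInformed_mem_hofOrderSet {t : Fin (m + 2) → ℝ} :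
    t ∈ soloInformedOrderSet (soloInformedHofPoset m) ↔
      (∀ j : Fin m, t (Fin.castSucc j.succ) < t (Fin.castSucc (Fin.castSucc j))) ∧
        t (Fin.last (m + 1)) < t 0 := by
  constructor
  · intro h
    exact ⟨fun j => h _ (List.mem_append_left _ (List.mem_map.2 ⟨j, List.mem_finRange j, rfl⟩)),
      h _ (List.mem_append_right _ (List.mem_singleton_self _))⟩
  · rintro ⟨h1, h2⟩ p hp
    rcases List.mem_append.1 hp with hp | hp
    · obtain ⟨j, -, rfl⟩ := List.mem_map.1 hp
      exact h1 j
    · rw [List.mem_singleton.1 hp]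
      exact h2

/-- The chain condition in terms of values. -/
theorem soloInformed_hofChain_iff {t : Fin (m + 2) → ℝ} :
    (∀ j : Fin m, t (Fin.castSucc j.succ) < t (Fin.castSucc (Fin.castSucc j))) ↔
      ∀ a b : Fin (m + 2), (a : ℕ) = b + 1 → (a : ℕ) ≤ m → t a < t b := by
  constructor
  · intro h a b hab ha
    have key := h ⟨b, by omega⟩
    have e1 : Fin.castSucc (Fin.succ (⟨b, by omega⟩ : Fin m)) = a := Fin.ext (by simp; omega)
    have e2 : Fin.castSucc (Fin.castSucc (⟨b, by omega⟩ : Fin m)) = b := Fin.ext (by simp)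
    rwa [e1, e2] at key
  · intro h j
    exact h _ _ (by simp) (by simp)

/-- The garland domain `𝒢 = (0,1)ⁿ ∩ P_E`. -/
def soloInformedHofGarland (m : ℕ) : Set (Fin (m + 2) → ℝ) :=
  soloInformedOpenCube (m + 2) ∩ soloInformedOrderSet (soloInformedHofPoset m)

/-- `𝒢` is `ℚ`-semialgebraic. -/
theorem soloInformed_isSemialgebraic_hofGarland : IsSemialgebraic ℚ (soloInformedHofGarland m) :=
  (isSemialgebraic_soloInformedOpenCube _).inter (soloInformed_isSemialgebraic_orderSet _)

/-- `𝒢` is measurable. -/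
theorem soloInformed_measurableSet_hofGarland : MeasurableSet (soloInformedHofGarland m) :=
  (soloInformed_measurableSet_openCube _).inter (soloInformed_measurableSet_orderSet _)

/-! ## 2. The garland integrand -/

/-- The letters of the garland integrand: the word of `u` on the chain, `1` at the pendant. -/
def soloInformedHofEps (u : List ℕ) (m : ℕ) : Fin (m + 2) → Bool :=
  Fin.snoc (α := fun _ => Bool) (soloInformedWordFn u m) true

/-- Auxiliary (Hoffman chart): the letter on the chain. -/
@[simp] theorem soloInformedHofEps_castSucc (u : List ℕ) (k : Fin (m + 1)) :
    soloInformedHofEps u m (Fin.castSucc k) = soloInformedWordFn u m k := by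
  simp [soloInformedHofEps]

/-- Auxiliary (Hoffman chart): the letter at the pendant. -/
@[simp] theorem soloInformedHofEps_last (u : List ℕ) :
    soloInformedHofEps u m (Fin.last (m + 1)) = true := by
  simp [soloInformedHofEps]

/-- The garland integrand `g(t) = ∏ᵢ ω_{εᵢ}(tᵢ)`. -/
def soloInformedHofG (u : List ℕ) (m : ℕ) (t : Fin (m + 2) → ℝ) : ℝ :=
  ∏ i, mzvForm (soloInformedHofEps u m i) (t i)

/-- `g(t) = (∏_{k ≤ m} ω_{ε_k}(t_k)) · 1/(1 − t_{m+1})`. -/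
theorem soloInformedHofG_eq (u : List ℕ) (t : Fin (m + 2) → ℝ) : soloInformedHofG u m t =
    (∏ k : Fin (m + 1), mzvForm (soloInformedWordFn u m k) (t (Fin.castSucc k))) *
      (1 / (1 - t (Fin.last (m + 1)))) := by
  unfold soloInformedHofG
  rw [Fin.prod_univ_castSucc]
  simp

/-- The denominator polynomial of `g`: `∏ᵢ (1 − Xᵢ)` or `Xᵢ` according to the letter. -/
def soloInformedHofDen (u : List ℕ) (m : ℕ) : MvPolynomial (Fin (m + 2)) ℚ :=
  ∏ i, if soloInformedHofEps u m i then 1 - X i else X i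

/-- `g = 1 / den`. -/
theorem soloInformedHofG_eq_div (u : List ℕ) (t : Fin (m + 2) → ℝ) :
    soloInformedHofG u m t = 1 / aeval t (soloInformedHofDen u m) := by
  unfold soloInformedHofG soloInformedHofDen
  rw [map_prod, one_div, ← Finset.prod_inv_distrib]
  refine Finset.prod_congr rfl fun i _ => ?_
  cases soloInformedHofEps u m i <;> simp

/-- The denominator is positive on the cube. -/
theorem soloInformed_hofDen_pos (u : List ℕ) {t : Fin (m + 2) → ℝ} (ht : t ∈ soloInformedOpenCube (m + 2)) :
    0 < (aeval t (soloInformedHofDen u m) : ℝ) := by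
  rw [soloInformedHofDen, map_prod]
  exact Finset.prod_pos fun i _ => by
    cases soloInformedHofEps u m i
    · simpa using (ht i).1
    · simpa using (ht i).2

/-! ## 3. The substitution `λ` -/

/-- The components of `λ`: prefix products, except the last which is `X_{m+1}`. -/
def soloInformedHofLamPoly (m : ℕ) (j : Fin (m + 2)) : MvPolynomial (Fin (m + 2)) ℚ :=
  if j = Fin.last (m + 1) then X (Fin.last (m + 1)) else soloInformedMonoPoly (m + 2) j

/-- `λ`. -/
def soloInformedHofLam (m : ℕ) : (Fin (m + 2) → ℝ) → Fin (m + 2) → ℝ :=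
  soloInformedPolyMap (soloInformedHofLamPoly m)

/-- `λ(x)_j = x₀ ⋯ x_j` for `j ≠ m+1`. -/
theorem soloInformedHofLam_of_ne (x : Fin (m + 2) → ℝ) {j : Fin (m + 2)} (hj : j ≠ Fin.last (m + 1)) :
    soloInformedHofLam m x j = soloInformedPrefixProd x j := by
  simp [soloInformedHofLam, soloInformedHofLamPoly, soloInformedPolyMap, hj, soloInformed_aeval_monoPoly]

/-- `λ(x)_{castSucc k} = x₀ ⋯ x_k`. -/
theorem soloInformedHofLam_castSucc (x : Fin (m + 2) → ℝ) (k : Fin (m + 1)) :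
    soloInformedHofLam m x (Fin.castSucc k) = soloInformedPrefixProd x (Fin.castSucc k) :=
  soloInformedHofLam_of_ne x (Fin.castSucc_lt_last k).ne

/-- `λ(x)_{m+1} = x_{m+1}`. -/
@[simp] theorem soloInformedHofLam_last (x : Fin (m + 2) → ℝ) :
    soloInformedHofLam m x (Fin.last (m + 1)) = x (Fin.last (m + 1)) := by
  simp [soloInformedHofLam, soloInformedHofLamPoly, soloInformedPolyMap]

/-- The first prefix product is `x₀`. -/
theorem soloInformed_prefixProd_zero₂ {A : Type*} [CommMonoid A] (x : Fin (m + 2) → A) :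
    soloInformedPrefixProd x 0 = x 0 := by
  rw [soloInformedPrefixProd]
  have h : Finset.univ.filter (fun i : Fin (m + 2) => i ≤ 0) = {0} := by
    ext i
    simp only [Finset.mem_filter, Finset.mem_univ, true_and, Finset.mem_singleton]
    exact ⟨fun h => le_antisymm h (Fin.zero_le _), fun h => h.le⟩
  rw [h, Finset.prod_singleton]

/-- The last prefix product splits off `x_{m+1}`. -/
theorem soloInformed_prefixProd_last₂ (x : Fin (m + 2) → ℝ) :
    soloInformedPrefixProd x (Fin.last (m + 1)) =
      x (Fin.last (m + 1)) * soloInformedPrefixProd x (Fin.castSucc (Fin.last m)) := by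
  have h := soloInformed_prefixProd_succ x (Fin.castSucc (Fin.last m)) (by simp)
  have e : (⟨(Fin.castSucc (Fin.last m) : Fin (m + 2)).1 + 1, by simp⟩ : Fin (m + 2)) =
      Fin.last (m + 1) := Fin.ext (by simp)
  rw [e] at h
  exact h

/-- Prefix products at `j ≠ m+1` ignore the last coordinate. -/
theorem soloInformed_prefixProd_update_last₂ {A : Type*} [CommMonoid A] (y : Fin (m + 2) → A) (v : A)
    {j : Fin (m + 2)} (hj : j ≠ Fin.last (m + 1)) :
    soloInformedPrefixProd (Function.update y (Fin.last (m + 1)) v) j = soloInformedPrefixProd y j :=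
  Finset.prod_congr rfl fun l hl => by
    rw [Function.update_of_ne]
    intro h
    have hle : l ≤ j := (Finset.mem_filter.1 hl).2
    rw [h] at hle
    exact hj (Fin.last_le_iff.1 hle)

/-- Prefix products at `castSucc k` are the prefix products of `Fin.init`. -/
theorem soloInformed_prefixProd_init {A : Type*} [CommMonoid A] (x : Fin (m + 2) → A) (k : Fin (m + 1)) :
    soloInformedPrefixProd (Fin.init x) k = soloInformedPrefixProd x (Fin.castSucc k) := by
  unfold soloInformedPrefixProd
  have h : Finset.univ.filter (fun i : Fin (m + 2) => i ≤ Fin.castSucc k) =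
      (Finset.univ.filter (fun i : Fin (m + 1) => i ≤ k)).map Fin.castSuccEmb := by
    ext i
    simp only [Finset.mem_filter, Finset.mem_univ, true_and, Finset.mem_map, Fin.castSuccEmb_apply]
    constructor
    · intro hi
      have hi' : (i : ℕ) ≤ k := by simpa [Fin.le_def] using hi
      exact ⟨⟨i, by omega⟩, Fin.le_def.2 (by simpa using hi'), Fin.ext rfl⟩
    · rintro ⟨l, hl, rfl⟩
      have hl' : (l : ℕ) ≤ k := Fin.le_def.1 hl
      exact Fin.le_def.2 (by simpa using hl')
  rw [h, Finset.prod_map]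
  rfl

/-- Above the diagonal the Jacobian matrix of `λ` vanishes. -/
theorem soloInformed_hofJacMat_of_lt {i j : Fin (m + 2)} (hij : i < j) :
    soloInformedJacMat (soloInformedHofLamPoly m) i j = 0 := by
  rw [soloInformedJacMat_apply, soloInformedHofLamPoly]
  split_ifs with h
  · exact absurd (h ▸ hij) (not_lt.2 (Fin.le_last j))
  · have := soloInformed_jacPoly_kappa_of_lt (m := m + 2) hij
    rwa [soloInformedJacMat_apply] at this

/-- The diagonal of the Jacobian matrix of `λ`. -/
theorem soloInformed_hofJacMat_diag (i : Fin (m + 2)) :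
    soloInformedJacMat (soloInformedHofLamPoly m) i i =
      if i = Fin.last (m + 1) then 1 else ∏ l ∈ Finset.univ.filter (fun l : Fin (m + 2) => l < i), X l := by
  rw [soloInformedJacMat_apply, soloInformedHofLamPoly]
  split_ifs with h
  · subst h; exact pderiv_X_self _
  · have := soloInformed_jacPoly_kappa_diag (m := m + 2) i
    rwa [soloInformedJacMat_apply] at this

/-- **`det J_λ = ∏_{i ≤ m} ∏_{l<i} X_l`** (lower triangular). -/
theorem soloInformed_det_hofJacMat (m : ℕ) : (soloInformedJacMat (soloInformedHofLamPoly m)).det =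
    ∏ i : Fin (m + 1), ∏ l ∈ Finset.univ.filter (fun l : Fin (m + 2) => l < Fin.castSucc i), X l := by
  rw [Matrix.det_of_lowerTriangular _ fun i j hij =>
    soloInformed_hofJacMat_of_lt (OrderDual.toDual_lt_toDual.1 hij), Fin.prod_univ_castSucc,
    soloInformed_hofJacMat_diag, if_pos rfl, mul_one]
  exact Finset.prod_congr rfl fun i _ => by
    rw [soloInformed_hofJacMat_diag, if_neg (Fin.castSucc_lt_last i).ne]

/-- **`det J_λ(x) = ∏_{j < m} λ(x)_j`.** -/
theorem soloInformed_det_hofLam (x : Fin (m + 2) → ℝ) :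
    (soloInformedJacCLM (soloInformedHofLamPoly m) x).det =
      ∏ j : Fin m, soloInformedPrefixProd x (Fin.castSucc (Fin.castSucc j)) := by
  rw [soloInformed_det_jacCLM, soloInformed_det_hofJacMat]
  simp only [map_prod, aeval_X]
  exact soloInformed_prod_prod_lt_castSucc x

/-- The Jacobian determinant is positive on the cube. -/
theorem soloInformed_det_hofLam_pos {x : Fin (m + 2) → ℝ} (hx : x ∈ soloInformedOpenCube (m + 2)) :
    0 < (soloInformedJacCLM (soloInformedHofLamPoly m) x).det := by
  rw [soloInformed_det_hofLam]
  exact Finset.prod_pos fun j _ => soloInformed_prefixProd_pos hx _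

/-- `λ` is injective on the open cube. -/
theorem soloInformed_injOn_hofLam : InjOn (soloInformedHofLam m) (soloInformedOpenCube (m + 2)) := by
  intro x hx x' _ h
  have hl : x (Fin.last (m + 1)) = x' (Fin.last (m + 1)) := by
    simpa using congr_fun h (Fin.last (m + 1))
  refine soloInformed_prefixProd_injective (fun j => (hx j).1.ne') fun j => ?_
  by_cases hj : j = Fin.last (m + 1)
  · subst hj
    rw [soloInformed_prefixProd_last₂, soloInformed_prefixProd_last₂, hl,
      ← soloInformedHofLam_of_ne x (Fin.castSucc_lt_last _).ne,
      ← soloInformedHofLam_of_ne x' (Fin.castSucc_lt_last _).ne, h]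
  · rw [← soloInformedHofLam_of_ne x hj, ← soloInformedHofLam_of_ne x' hj, h]

/-- **`λ((0,1)ⁿ ∩ {x_{m+1} < x₀}) = 𝒢`.** -/
theorem soloInformed_image_hofLam : soloInformedHofLam m ''
    (soloInformedOpenCube (m + 2) ∩ {x | x (Fin.last (m + 1)) < x 0}) = soloInformedHofGarland m := by
  refine Subset.antisymm ?_ fun t ht => ?_
  · rintro _ ⟨x, ⟨hx, hl0⟩, rfl⟩
    have hl0' : x (Fin.last (m + 1)) < x 0 := hl0
    have hc := soloInformedOpenCube_subset_cube _ hx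
    refine ⟨fun j => ?_, soloInformed_mem_hofOrderSet.2 ⟨fun j => ?_, ?_⟩⟩
    · by_cases hj : j = Fin.last (m + 1)
      · subst hj; simpa using hx (Fin.last (m + 1))
      · rw [soloInformedHofLam_of_ne x hj]
        exact ⟨soloInformed_prefixProd_pos hx j,
          (soloInformed_prefixProd_le_apply hc j).trans_lt (hx j).2⟩
    · rw [soloInformedHofLam_of_ne x (Fin.castSucc_lt_last _).ne,
        soloInformedHofLam_of_ne x (Fin.castSucc_lt_last _).ne]
      exact soloInformed_prefixProd_strictAnti hx (Fin.lt_def.2 (by simp))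
    · rw [soloInformedHofLam_last, soloInformedHofLam_of_ne x (ne_of_lt (Fin.last_pos : (0 : Fin (m + 2)) < Fin.last (m + 1))),
        soloInformed_prefixProd_zero₂]
      exact hl0'
  · have hcube := ht.1
    have hord := soloInformed_mem_hofOrderSet.1 ht.2
    have hchain := soloInformed_hofChain_iff.1 hord.1
    have hne : ∀ j, t j ≠ 0 := fun j => (hcube j).1.ne'
    set x : Fin (m + 2) → ℝ :=
      Function.update (soloInformedPrefixInv t) (Fin.last (m + 1)) (t (Fin.last (m + 1))) with hxdef
    have hlam : soloInformedHofLam m x = t := by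
      funext j
      by_cases hj : j = Fin.last (m + 1)
      · subst hj; simp [hxdef]
      · rw [soloInformedHofLam_of_ne x hj, hxdef, soloInformed_prefixProd_update_last₂ _ _ hj,
          soloInformed_prefixProd_prefixInv t hne]
    refine ⟨x, ⟨fun j => ?_, ?_⟩, hlam⟩
    · by_cases hj : j = Fin.last (m + 1)
      · subst hj; simpa [hxdef] using hcube (Fin.last (m + 1))
      · rw [hxdef, Function.update_of_ne hj, soloInformedPrefixInv]
        split_ifs with h0
        · exact hcube j
        · have hlt : t j < t ⟨j.1 - 1, by omega⟩ :=
            hchain j ⟨j.1 - 1, by omega⟩ (by simp; omega) (by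
              have := Fin.val_lt_last hj; simp at this ⊢; omega)
          exact ⟨div_pos (hcube j).1 (hcube _).1, (div_lt_one (hcube _).1).2 hlt⟩
    · show x (Fin.last (m + 1)) < x 0
      have hx0 : x 0 = t 0 := by
        rw [hxdef, Function.update_of_ne (ne_of_lt (Fin.last_pos : (0 : Fin (m + 2)) < Fin.last (m + 1))), soloInformedPrefixInv]
        simp
      rw [hx0, hxdef, Function.update_self]
      exact hord.2


end Summit.KontsevichZagierPeriods.KontsevichZagierPeriods.Theorems
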